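/-
Copyright (c) 2026 the pub-hodgecm-mathlib formalisation cell (harness21).  Prover seat hodgecm-mathlib-K2E3-p17 (g8), Track B «K2-LIT» ∕ h413
(`stmt-HodgeConjecture-24833`), line `K2_E3_EllipticInputs`, leaf (nsc-S-A′), H-layer brick LEV-3 (structure file) of `MEMO-H4-residues.v1.K2E3-p25-g0.md` §1
(architect K2E3-p25 (g0); dealer K2E3-plan (g4) RULINGS #3 (R-9) D76).  2026-09-04.
-/
import Literature.NumberTheory.Automorphic.GL3UpperUnipotentTwistedConjugation   -- ★ root group `U₃ ⊓ M_{(2,1)}`: `eq_transvection_of_mem_rootGroup_fin_three`, `exists_homeomorph_rootGroup_fin_three`, `mem_…_of_eq_transvection`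
import Literature.NumberTheory.Automorphic.InducedWhittakerVanishing              -- ★ `permGL_inv`, `coe_permGL_mul_mul_inv`, `transvectionGL_apply`, `whittakerChar`
import Literature.NumberTheory.Automorphic.GLnCongruenceSubgroups                 -- ★ `mem_unipotentRadicalGL_iff_apply`
import Literature.NumberTheory.Automorphic.GLnTwoBlockLeviStructure               -- ★ `mem_standardLeviGL_iff`
import Literature.NumberTheory.Automorphic.SiegelMultiplicity                     -- ★ `unipotentRadicalGL_le_upperUnitriangular`
import HarnessLib

/-!
# Crux `H413` — K2-LIT E3, H-layer brick LEV-3 (structure file): the unipotent radical `U₃` of `GL₃`, its pieces `U_Q ⊴ U₃ ⊵ U_{α₁}`, their characters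
# `ψ(a u₀₁ + b u₁₂)`, `ψ(a n₀₂ + b n₁₂)`, and the conjugations (torus, Levi transvection, Weyl swap) that move them

Cell `hodgecm-mathlib`, Track B, line `K2_E3_EllipticInputs`, leaf (nsc-S-A′), H-layer rule (lev) (architect K2E3-p25 (g0) `MEMO-H4-residues.v1` §1).  Pure `GL₃` matrix
structure, THEOREMS ONLY (no `def`: the subgroups are the tree's `upperUnitriangular (Fin 3) F`, `unipotentRadicalGL F ![false,false,true]` = `U_Q` (type `(2,1)`: entries
`(0,2), (1,2)` free, `u₀₁ = 0`) and the root group `unipotentRadicalGL F id ⊓ standardLeviGL F ![false,false,true]` = `U_{α₁}` (★ `GL3UpperUnipotentTwistedConjugation`);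
characters are produced as THEOREM-LEVEL data `∃ θ : ↥_ →* ℂˣ, ∀ u, (θ u : ℂ) = ψ (…)`); count-neutral helper (`--supports stmt-HodgeConjecture-24833 --as helper`).

* §1 entries of `u ∈ U₃`, `n ∈ U_Q`, `h ∈ U_{α₁}`; `U_Q = {u ∈ U₃ | u₀₁ = 0}`; additivity of the entries `(0,1)`, `(1,2)` on `U₃` and `(0,2)` on `U_Q` under products.
* §2 characters: `exists_character_of_additive` (any additive functional `ℓ` gives `u ↦ ψ(ℓ u)` as `↥M →* ℂˣ`), `exists_character_upperUnitriangular ψ a b`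
  (`u ↦ ψ(a u₀₁ + b u₁₂)`), `exists_character_unipotentRadical ψ a b` (`n ↦ ψ(a n₀₂ + b n₁₂)`), `coe_whittakerChar_three` (`ψ_nd(u) = ψ(u₀₁ + u₁₂)`).
* §3 `U₃ = U_Q · U_{α₁}` (`exists_mul_eq_of_mem_upperUnitriangular`, `sup_eq`), both abelian, `U_{α₁}` normalises `U_Q` fixing the entry `(1,2)`.
* §4 conjugation data `x⁻¹ (·) x` for `x = diag(c,1,1)` on `U₃`, and for `x = T₁₀(a)`, `diag(1,b,1)`, `P_{(01)}` on `U_Q` (membership + the moved entries) — the inputs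
  of ★ LEV-3 kit `K2E3TwistedKernelTransport.ker_charTwist_eq_top_of_conj`.

HONEST LABEL: HC_CM is proved only modulo the 7 printed citations (2 remaining named inputs: hLiu418 = stmt-HodgeConjecture-24832, h413 =
stmt-HodgeConjecture-24833) until rung 0 closes; elementary, closes no organ by itself.

## References
* [BernsteinZelevinskyASENS1977] I. N. Bernstein, A. V. Zelevinsky, *Induced representations of reductive p-adic groups I*, Ann. Sci. ÉNS 10 (1977), §2.1, §3.2, 4.7.
* [Zelevinsky1980] A. V. Zelevinsky, *Induced representations of reductive p-adic groups II*, Ann. Sci. ÉNS 13 (1980), §3.7.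
-/

set_option autoImplicit false
-- the mandated namespace repeats `HodgeConjecture.HodgeConjecture`, as in every `Theorems/*.lean` of this sub-problem
set_option linter.dupNamespace false

noncomputable section

open Matrix Literature.NumberTheory.Automorphic
open scoped MatrixGroups

namespace Summit.HodgeConjecture.HodgeConjecture.Cruxes.H413.K2E3GL3UnipotentCharacters

/-! ## §1 Entries -/

section Entries

variable {F : Type*} [Field F]

/-- `U_Q ≤ U₃` (the labelling `(false, false, true)` is monotone, cf. ★ `K2E3GL3InductionInStagesEmbedding.monotone_twoOne`). [cite: BernsteinZelevinskyASENS1977, §2.1] -/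
theorem unipotentRadical21_le : unipotentRadicalGL F ![false, false, true] ≤ upperUnitriangular (Fin 3) F :=
  unipotentRadicalGL_le_upperUnitriangular _ (by decide)

/-- Entries of `u ∈ U₃`: unit diagonal, zero below. [folklore] -/
theorem entries_of_mem_upperUnitriangular {u : GL (Fin 3) F} (hu : u ∈ upperUnitriangular (Fin 3) F) :
    (u : Matrix (Fin 3) (Fin 3) F) 0 0 = 1 ∧ (u : Matrix (Fin 3) (Fin 3) F) 1 1 = 1 ∧ (u : Matrix (Fin 3) (Fin 3) F) 2 2 = 1 ∧
      (u : Matrix (Fin 3) (Fin 3) F) 1 0 = 0 ∧ (u : Matrix (Fin 3) (Fin 3) F) 2 0 = 0 ∧ (u : Matrix (Fin 3) (Fin 3) F) 2 1 = 0 := by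
  have hu' : u ∈ unipotentRadicalGL F (id : Fin 3 → Fin 3) := hu
  rw [mem_unipotentRadicalGL_iff_apply] at hu'
  refine ⟨?_, ?_, ?_, ?_, ?_, ?_⟩
  · rw [hu' 0 0 le_rfl, Matrix.one_apply_eq]
  · rw [hu' 1 1 le_rfl, Matrix.one_apply_eq]
  · rw [hu' 2 2 le_rfl, Matrix.one_apply_eq]
  · rw [hu' 1 0 (by decide), Matrix.one_apply_ne (by decide)]
  · rw [hu' 2 0 (by decide), Matrix.one_apply_ne (by decide)]
  · rw [hu' 2 1 (by decide), Matrix.one_apply_ne (by decide)]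

/-- Membership in `U₃` from the entries. [folklore] -/
theorem mem_upperUnitriangular_of_entries {g : GL (Fin 3) F}
    (h00 : (g : Matrix (Fin 3) (Fin 3) F) 0 0 = 1) (h11 : (g : Matrix (Fin 3) (Fin 3) F) 1 1 = 1) (h22 : (g : Matrix (Fin 3) (Fin 3) F) 2 2 = 1)
    (h10 : (g : Matrix (Fin 3) (Fin 3) F) 1 0 = 0) (h20 : (g : Matrix (Fin 3) (Fin 3) F) 2 0 = 0) (h21 : (g : Matrix (Fin 3) (Fin 3) F) 2 1 = 0) :
    g ∈ upperUnitriangular (Fin 3) F := by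
  show g ∈ unipotentRadicalGL F (id : Fin 3 → Fin 3)
  rw [mem_unipotentRadicalGL_iff_apply]
  intro i j hij
  fin_cases i <;> fin_cases j
  · simpa using h00
  · exact absurd hij (by decide)
  · exact absurd hij (by decide)
  · simpa using h10
  · simpa using h11
  · exact absurd hij (by decide)
  · simpa using h20
  · simpa using h21
  · simpa using h22

/-- **`U_Q = {u ∈ U₃ | u₀₁ = 0}`** (type `(2,1)`: the entry `(0,1)` lies inside the first diagonal block). [cite: BernsteinZelevinskyASENS1977, §2.1] -/
theorem mem_unipotentRadical21_iff (g : GL (Fin 3) F) :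
    g ∈ unipotentRadicalGL F ![false, false, true] ↔ g ∈ upperUnitriangular (Fin 3) F ∧ (g : Matrix (Fin 3) (Fin 3) F) 0 1 = 0 := by
  constructor
  · intro hg
    refine ⟨unipotentRadical21_le hg, ?_⟩
    rw [mem_unipotentRadicalGL_iff_apply] at hg
    rw [hg 0 1 (by decide), Matrix.one_apply_ne (by decide)]
  · rintro ⟨hU, h01⟩
    obtain ⟨h00, h11, h22, h10, h20, h21⟩ := entries_of_mem_upperUnitriangular hU
    rw [mem_unipotentRadicalGL_iff_apply]
    intro i j hij
    fin_cases i <;> fin_cases j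
    · simpa using h00
    · simpa using h01
    · exact absurd hij (by decide)
    · simpa using h10
    · simpa using h11
    · exact absurd hij (by decide)
    · simpa using h20
    · simpa using h21
    · simpa using h22

/-- Entries of `h` in the root group `U_{α₁} = U₃ ⊓ M_{(2,1)}`: `h₀₂ = h₁₂ = 0` (block diagonal). [cite: BernsteinZelevinskyASENS1977, §2.1] -/
theorem entries_of_mem_rootGroup {h : GL (Fin 3) F} (hh : h ∈ unipotentRadicalGL F (id : Fin 3 → Fin 3) ⊓ standardLeviGL F ![false, false, true]) :
    (h : Matrix (Fin 3) (Fin 3) F) 0 2 = 0 ∧ (h : Matrix (Fin 3) (Fin 3) F) 1 2 = 0 := by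
  have hM := (mem_standardLeviGL_iff _ h).1 hh.2
  exact ⟨hM 0 2 (by decide), hM 1 2 (by decide)⟩

/-- **Additivity of the super-diagonal entries on `U₃`**: `(uv)₀₁ = u₀₁ + v₀₁`, `(uv)₁₂ = u₁₂ + v₁₂`. [cite: BernsteinZelevinskyASENS1977, §3.2] -/
theorem superdiag_apply_mul {u v : GL (Fin 3) F} (hu : u ∈ upperUnitriangular (Fin 3) F) (hv : v ∈ upperUnitriangular (Fin 3) F) :
    ((u * v : GL (Fin 3) F) : Matrix (Fin 3) (Fin 3) F) 0 1 = (u : Matrix (Fin 3) (Fin 3) F) 0 1 + (v : Matrix (Fin 3) (Fin 3) F) 0 1 ∧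
      ((u * v : GL (Fin 3) F) : Matrix (Fin 3) (Fin 3) F) 1 2 = (u : Matrix (Fin 3) (Fin 3) F) 1 2 + (v : Matrix (Fin 3) (Fin 3) F) 1 2 := by
  obtain ⟨hu00, hu11, -, hu10, -, -⟩ := entries_of_mem_upperUnitriangular hu
  obtain ⟨-, hv11, hv22, -, -, hv21⟩ := entries_of_mem_upperUnitriangular hv
  refine ⟨?_, ?_⟩
  · rw [Units.val_mul, Matrix.mul_apply, Fin.sum_univ_three, hu00, hv11, hv21]; ring
  · rw [Units.val_mul, Matrix.mul_apply, Fin.sum_univ_three, hu10, hu11, hv22]; ring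

/-- **Additivity of the free entries on `U_Q`**: `(nn′)₀₂ = n₀₂ + n′₀₂` (and `(nn′)₁₂ = n₁₂ + n′₁₂` by `superdiag_apply_mul`). [cite: BernsteinZelevinskyASENS1977, §3.2] -/
theorem apply02_mul_of_mem_unipotentRadical21 {n n' : GL (Fin 3) F} (hn : n ∈ unipotentRadicalGL F ![false, false, true])
    (hn' : n' ∈ unipotentRadicalGL F ![false, false, true]) :
    ((n * n' : GL (Fin 3) F) : Matrix (Fin 3) (Fin 3) F) 0 2 = (n : Matrix (Fin 3) (Fin 3) F) 0 2 + (n' : Matrix (Fin 3) (Fin 3) F) 0 2 := by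
  obtain ⟨hU, h01⟩ := (mem_unipotentRadical21_iff n).1 hn
  obtain ⟨hU', -⟩ := (mem_unipotentRadical21_iff n').1 hn'
  obtain ⟨hn00, -, -, -, -, -⟩ := entries_of_mem_upperUnitriangular hU
  obtain ⟨-, -, hn'22, -, -, -⟩ := entries_of_mem_upperUnitriangular hU'
  rw [Units.val_mul, Matrix.mul_apply, Fin.sum_univ_three, hn00, h01, hn'22]; ring

end Entries

/-! ## §2 Characters -/

section Characters

variable {F : Type*} [Field F]

/-- **A character from an additive functional**: if `ℓ : M → F` satisfies `ℓ 1 = 0`, `ℓ(xy) = ℓ x + ℓ y`, then `x ↦ ψ(ℓ x)` is a homomorphism `M →* ℂˣ`.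
[cite: BernsteinZelevinskyASENS1977, §3.2] -/
theorem exists_character_of_additive {M : Type*} [Group M] (ψ : AddChar F Circle) (ℓ : M → F) (h1 : ℓ 1 = 0) (hmul : ∀ x y, ℓ (x * y) = ℓ x + ℓ y) :
    ∃ θ : M →* ℂˣ, ∀ m, ((θ m : ℂˣ) : ℂ) = ψ (ℓ m) := by
  refine ⟨{ toFun := fun m => Circle.toUnits (ψ (ℓ m))
            map_one' := by rw [h1, AddChar.map_zero_eq_one, map_one]
            map_mul' := fun x y => by rw [hmul, AddChar.map_add_eq_mul, map_mul] }, fun m => ?_⟩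
  rfl

/-- **The characters `u ↦ ψ(a u₀₁ + b u₁₂)` of `U₃`** (all characters trivial on the commutator `U_{02}` are of this form; `a = b = 1` is the non-degenerate `ψ_nd`,
`a = 0, b = 1` is the degenerate `ψ′` of rule (lev)). [cite: BernsteinZelevinskyASENS1977, §3.2] [cite: Zelevinsky1980, §3.7] -/
theorem exists_character_upperUnitriangular (ψ : AddChar F Circle) (a b : F) :
    ∃ θ : ↥(upperUnitriangular (Fin 3) F) →* ℂˣ, ∀ u : ↥(upperUnitriangular (Fin 3) F),
      ((θ u : ℂˣ) : ℂ) = ψ (a * ((u : GL (Fin 3) F) : Matrix (Fin 3) (Fin 3) F) 0 1 + b * ((u : GL (Fin 3) F) : Matrix (Fin 3) (Fin 3) F) 1 2) := by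
  refine exists_character_of_additive ψ (fun u : ↥(upperUnitriangular (Fin 3) F) =>
    a * ((u : GL (Fin 3) F) : Matrix (Fin 3) (Fin 3) F) 0 1 + b * ((u : GL (Fin 3) F) : Matrix (Fin 3) (Fin 3) F) 1 2) ?_ ?_
  · simp [Matrix.one_apply_ne]
  · intro x y
    obtain ⟨h01, h12⟩ := superdiag_apply_mul x.2 y.2
    simp only [Subgroup.coe_mul, h01, h12]
    ring

/-- **The characters `n ↦ ψ(a n₀₂ + b n₁₂)` of the abelian `U_Q ≅ F²`** (`a = 0, b = 1` is `Ψ₁ = ψ′|_{U_Q}`). [cite: BernsteinZelevinskyASENS1977, §3.2] -/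
theorem exists_character_unipotentRadical (ψ : AddChar F Circle) (a b : F) :
    ∃ Θ : ↥(unipotentRadicalGL F ![false, false, true]) →* ℂˣ, ∀ n : ↥(unipotentRadicalGL F ![false, false, true]),
      ((Θ n : ℂˣ) : ℂ) = ψ (a * ((n : GL (Fin 3) F) : Matrix (Fin 3) (Fin 3) F) 0 2 + b * ((n : GL (Fin 3) F) : Matrix (Fin 3) (Fin 3) F) 1 2) := by
  refine exists_character_of_additive ψ (fun n : ↥(unipotentRadicalGL F ![false, false, true]) =>
    a * ((n : GL (Fin 3) F) : Matrix (Fin 3) (Fin 3) F) 0 2 + b * ((n : GL (Fin 3) F) : Matrix (Fin 3) (Fin 3) F) 1 2) ?_ ?_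
  · simp [Matrix.one_apply_ne]
  · intro x y
    have h02 := apply02_mul_of_mem_unipotentRadical21 x.2 y.2
    obtain ⟨-, h12⟩ := superdiag_apply_mul (unipotentRadical21_le x.2) (unipotentRadical21_le y.2)
    simp only [Subgroup.coe_mul, h02, h12]
    ring

/-- **`ψ_nd(u) = ψ(u₀₁ + u₁₂)`** on `U₃` (★ `whittakerChar`, `superdiagSum` at `n = 3`). [cite: BernsteinZelevinskyASENS1977, §3.2] -/
theorem coe_whittakerChar_three (ψ : AddChar F Circle) (u : ↥(upperUnitriangular (Fin 3) F)) :
    ((whittakerChar (n := 3) ψ u : ℂˣ) : ℂ) = ψ (((u : GL (Fin 3) F) : Matrix (Fin 3) (Fin 3) F) 0 1 + ((u : GL (Fin 3) F) : Matrix (Fin 3) (Fin 3) F) 1 2) := by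
  rw [coe_whittakerChar, whittakerCharFun_apply, superdiagSum_def]
  congr 1
  simp [Fin.sum_univ_three]

end Characters

/-! ## §3 `U₃ = U_Q · U_{α₁}`, commutativity, normalisation -/

section Decomposition

variable {F : Type*} [Field F]

/-- The transvection `T₀₁(x)` lies in the root group `U_{α₁} = U₃ ⊓ M_{(2,1)}`. [cite: BernsteinZelevinskyASENS1977, §2.1] -/
theorem transvectionGL01_mem_rootGroup (x : F) :
    transvectionGL (0 : Fin 3) 1 (by decide) x ∈ unipotentRadicalGL F (id : Fin 3 → Fin 3) ⊓ standardLeviGL F ![false, false, true] :=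
  ⟨mem_unipotentRadicalGL_id_of_eq_transvection (by decide) x _ (coe_transvectionGL _ _ _ _),
    mem_standardLeviGL_of_eq_transvection _ (by decide) x _ (coe_transvectionGL _ _ _ _)⟩

/-- **`U₃ = U_Q · U_{α₁}`**: every `u ∈ U₃` is `n · h` with `n = u · T₀₁(−u₀₁) ∈ U_Q` and `h = T₀₁(u₀₁) ∈ U_{α₁}`. [cite: BernsteinZelevinskyASENS1977, §2.1] -/
theorem exists_mul_eq_of_mem_upperUnitriangular {u : GL (Fin 3) F} (hu : u ∈ upperUnitriangular (Fin 3) F) :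
    ∃ n ∈ unipotentRadicalGL F ![false, false, true], ∃ h ∈ unipotentRadicalGL F (id : Fin 3 → Fin 3) ⊓ standardLeviGL F ![false, false, true], u = n * h := by
  set x : F := (u : Matrix (Fin 3) (Fin 3) F) 0 1 with hx
  refine ⟨u * transvectionGL (0 : Fin 3) 1 (by decide) (-x), ?_, transvectionGL (0 : Fin 3) 1 (by decide) x, transvectionGL01_mem_rootGroup x, ?_⟩
  · rw [mem_unipotentRadical21_iff]
    refine ⟨Subgroup.mul_mem _ hu (transvectionGL01_mem_rootGroup (-x)).1, ?_⟩
    obtain ⟨h00, -, -, -, -, -⟩ := entries_of_mem_upperUnitriangular hu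
    rw [Units.val_mul, coe_transvectionGL, Matrix.mul_transvection_apply_same, h00, ← hx]; ring
  · rw [transvectionGL_neg, inv_mul_cancel_right]

/-- `U_Q ⊔ U_{α₁} = U₃`. [cite: BernsteinZelevinskyASENS1977, §2.1] -/
theorem unipotentRadical21_sup_rootGroup_eq :
    unipotentRadicalGL F ![false, false, true] ⊔ (unipotentRadicalGL F (id : Fin 3 → Fin 3) ⊓ standardLeviGL F ![false, false, true]) = upperUnitriangular (Fin 3) F := by
  refine le_antisymm (sup_le unipotentRadical21_le fun g hg => hg.1) fun u hu => ?_
  obtain ⟨n, hn, h, hh, rfl⟩ := exists_mul_eq_of_mem_upperUnitriangular hu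
  exact Subgroup.mul_mem _ (Subgroup.mem_sup_left hn) (Subgroup.mem_sup_right hh)

/-- An element of `U_Q` is determined by its entries `(0,2), (1,2)`: two elements with the same free entries are equal. [folklore] -/
theorem eq_of_mem_unipotentRadical21 {n n' : GL (Fin 3) F} (hn : n ∈ unipotentRadicalGL F ![false, false, true]) (hn' : n' ∈ unipotentRadicalGL F ![false, false, true])
    (h02 : (n : Matrix (Fin 3) (Fin 3) F) 0 2 = (n' : Matrix (Fin 3) (Fin 3) F) 0 2) (h12 : (n : Matrix (Fin 3) (Fin 3) F) 1 2 = (n' : Matrix (Fin 3) (Fin 3) F) 1 2) :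
    n = n' := by
  obtain ⟨hU, h01⟩ := (mem_unipotentRadical21_iff n).1 hn
  obtain ⟨hU', h01'⟩ := (mem_unipotentRadical21_iff n').1 hn'
  obtain ⟨a00, a11, a22, a10, a20, a21⟩ := entries_of_mem_upperUnitriangular hU
  obtain ⟨b00, b11, b22, b10, b20, b21⟩ := entries_of_mem_upperUnitriangular hU'
  refine Units.ext (Matrix.ext fun i j => ?_)
  fin_cases i <;> fin_cases j
  · exact a00.trans b00.symm
  · exact h01.trans h01'.symm
  · exact h02
  · exact a10.trans b10.symm
  · exact a11.trans b11.symm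
  · exact h12
  · exact a20.trans b20.symm
  · exact a21.trans b21.symm
  · exact a22.trans b22.symm

/-- **`U_Q` is abelian** (`≅ F²`). [cite: BernsteinZelevinskyASENS1977, §2.1] -/
theorem mul_comm_of_mem_unipotentRadical21 {n n' : GL (Fin 3) F} (hn : n ∈ unipotentRadicalGL F ![false, false, true]) (hn' : n' ∈ unipotentRadicalGL F ![false, false, true]) :
    n * n' = n' * n := by
  refine eq_of_mem_unipotentRadical21 (Subgroup.mul_mem _ hn hn') (Subgroup.mul_mem _ hn' hn) ?_ ?_
  · rw [apply02_mul_of_mem_unipotentRadical21 hn hn', apply02_mul_of_mem_unipotentRadical21 hn' hn, add_comm]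
  · rw [(superdiag_apply_mul (unipotentRadical21_le hn) (unipotentRadical21_le hn')).2,
      (superdiag_apply_mul (unipotentRadical21_le hn') (unipotentRadical21_le hn)).2, add_comm]

/-- **`U_{α₁}` is abelian** (`≅ F`: its elements are the `T₀₁(x)`, ★ `eq_transvection_of_mem_rootGroup_fin_three`). [cite: BernsteinZelevinskyASENS1977, §2.1] -/
theorem mul_comm_of_mem_rootGroup {h h' : GL (Fin 3) F} (hh : h ∈ unipotentRadicalGL F (id : Fin 3 → Fin 3) ⊓ standardLeviGL F ![false, false, true])
    (hh' : h' ∈ unipotentRadicalGL F (id : Fin 3 → Fin 3) ⊓ standardLeviGL F ![false, false, true]) : h * h' = h' * h := by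
  have e := eq_transvection_of_mem_rootGroup_fin_three h hh.1 hh.2
  have e' := eq_transvection_of_mem_rootGroup_fin_three h' hh'.1 hh'.2
  refine Units.ext ?_
  rw [Units.val_mul, Units.val_mul, e, e', Matrix.transvection_mul_transvection_same _ _ (by decide), Matrix.transvection_mul_transvection_same _ _ (by decide), add_comm]

/-- **`U_{α₁}` normalises `U_Q` and fixes the entry `(1,2)`**: for `h ∈ U_{α₁}`, `n ∈ U_Q`: `h⁻¹ n h ∈ U_Q` and `(h⁻¹ n h)₁₂ = n₁₂`
(`T₀₁(−x) n T₀₁(x) = 1 + (n₀₂ − x n₁₂) E₀₂ + n₁₂ E₁₂`). [cite: BernsteinZelevinskyASENS1977, §2.1] -/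
theorem conj_mem_unipotentRadical21_of_mem_rootGroup {h n : GL (Fin 3) F} (hh : h ∈ unipotentRadicalGL F (id : Fin 3 → Fin 3) ⊓ standardLeviGL F ![false, false, true])
    (hn : n ∈ unipotentRadicalGL F ![false, false, true]) :
    h⁻¹ * n * h ∈ unipotentRadicalGL F ![false, false, true] ∧ ((h⁻¹ * n * h : GL (Fin 3) F) : Matrix (Fin 3) (Fin 3) F) 1 2 = (n : Matrix (Fin 3) (Fin 3) F) 1 2 := by
  obtain ⟨hU, h01⟩ := (mem_unipotentRadical21_iff n).1 hn
  obtain ⟨n00, n11, -, n10, -, -⟩ := entries_of_mem_upperUnitriangular hU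
  set x : F := (h : Matrix (Fin 3) (Fin 3) F) 0 1 with hx
  have e : (h : Matrix (Fin 3) (Fin 3) F) = Matrix.transvection 0 1 x := eq_transvection_of_mem_rootGroup_fin_three h hh.1 hh.2
  have einv : ((h⁻¹ : GL (Fin 3) F) : Matrix (Fin 3) (Fin 3) F) = Matrix.transvection 0 1 (-x) := by
    rw [Matrix.coe_units_inv, e]
    exact Matrix.inv_eq_left_inv (by rw [Matrix.transvection_mul_transvection_same _ _ (by decide), neg_add_cancel, Matrix.transvection_zero])
  have hmem : h⁻¹ * n * h ∈ upperUnitriangular (Fin 3) F := Subgroup.mul_mem _ (Subgroup.mul_mem _ (Subgroup.inv_mem _ hh.1) hU) hh.1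
  have hprod : ((h⁻¹ * n * h : GL (Fin 3) F) : Matrix (Fin 3) (Fin 3) F) =
      Matrix.transvection (0 : Fin 3) 1 (-x) * (n : Matrix (Fin 3) (Fin 3) F) * Matrix.transvection (0 : Fin 3) 1 x := by
    rw [Units.val_mul, Units.val_mul, einv, e]
  have h12 : ((h⁻¹ * n * h : GL (Fin 3) F) : Matrix (Fin 3) (Fin 3) F) 1 2 = (n : Matrix (Fin 3) (Fin 3) F) 1 2 := by
    rw [hprod]
    simp [Matrix.mul_apply, Fin.sum_univ_three, Matrix.transvection, n10, n11]
  refine ⟨(mem_unipotentRadical21_iff _).2 ⟨hmem, ?_⟩, h12⟩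
  rw [hprod]
  simp [Matrix.mul_apply, Fin.sum_univ_three, Matrix.transvection, Matrix.single_apply, h01, n00, n11, n10]

end Decomposition

/-! ## §4 Conjugation data for the transports -/

section Conjugation

variable {F : Type*} [Field F]

/-- **THE TORUS `diag(c,1,1)` ON `U₃`**: for `x = diag(c,1,1)` and `u ∈ U₃`, `x⁻¹ u x ∈ U₃` with `(x⁻¹ux)₀₁ = c⁻¹ u₀₁`, `(x⁻¹ux)₁₂ = u₁₂` — so
`ψ(c·(x⁻¹ux)₀₁ + (x⁻¹ux)₁₂) = ψ_nd(u)`. [cite: BernsteinZelevinskyASENS1977, 4.7] -/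
theorem torus_conj_upperUnitriangular (c : Fˣ) {u : GL (Fin 3) F} (hu : u ∈ upperUnitriangular (Fin 3) F) :
    (diagonalGL (Fin 3) F ![c, 1, 1])⁻¹ * u * diagonalGL (Fin 3) F ![c, 1, 1] ∈ upperUnitriangular (Fin 3) F ∧
      (((diagonalGL (Fin 3) F ![c, 1, 1])⁻¹ * u * diagonalGL (Fin 3) F ![c, 1, 1] : GL (Fin 3) F) : Matrix (Fin 3) (Fin 3) F) 0 1 =
          ((c⁻¹ : Fˣ) : F) * (u : Matrix (Fin 3) (Fin 3) F) 0 1 ∧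
      (((diagonalGL (Fin 3) F ![c, 1, 1])⁻¹ * u * diagonalGL (Fin 3) F ![c, 1, 1] : GL (Fin 3) F) : Matrix (Fin 3) (Fin 3) F) 1 2 = (u : Matrix (Fin 3) (Fin 3) F) 1 2 := by
  have hinv : (diagonalGL (Fin 3) F ![c, 1, 1])⁻¹ = diagonalGL (Fin 3) F (![c, 1, 1])⁻¹ := (map_inv _ _).symm
  have hinv' : diagonalGL (Fin 3) F ![c, 1, 1] = (diagonalGL (Fin 3) F (![c, 1, 1])⁻¹)⁻¹ := by rw [map_inv, inv_inv]
  rw [hinv, hinv']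
  refine ⟨diagonalGL_conj_mem_upperUnitriangular _ hu, ?_, ?_⟩
  · rw [diagonalGL_conj_apply]; simp
  · rw [diagonalGL_conj_apply]; simp

/-- **THE LEVI TRANSVECTION `T₁₀(a)` ON `U_Q`**: `x = T₁₀(a)` satisfies `x⁻¹ n x ∈ U_Q` with `(x⁻¹nx)₀₂ = n₀₂`, `(x⁻¹nx)₁₂ = n₁₂ − a n₀₂`
(`T₁₀(−a)(1 + n₀₂E₀₂ + n₁₂E₁₂)T₁₀(a) = 1 + n₀₂E₀₂ + (n₁₂ − a n₀₂)E₁₂`). [cite: BernsteinZelevinskyASENS1977, 4.7] -/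
theorem levi_transvection_conj_unipotentRadical21 (a : F) {n : GL (Fin 3) F} (hn : n ∈ unipotentRadicalGL F ![false, false, true]) :
    (transvectionGL (1 : Fin 3) 0 (by decide) a)⁻¹ * n * transvectionGL (1 : Fin 3) 0 (by decide) a ∈ unipotentRadicalGL F ![false, false, true] ∧
      (((transvectionGL (1 : Fin 3) 0 (by decide) a)⁻¹ * n * transvectionGL (1 : Fin 3) 0 (by decide) a : GL (Fin 3) F) : Matrix (Fin 3) (Fin 3) F) 0 2 =
          (n : Matrix (Fin 3) (Fin 3) F) 0 2 ∧
      (((transvectionGL (1 : Fin 3) 0 (by decide) a)⁻¹ * n * transvectionGL (1 : Fin 3) 0 (by decide) a : GL (Fin 3) F) : Matrix (Fin 3) (Fin 3) F) 1 2 =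
          (n : Matrix (Fin 3) (Fin 3) F) 1 2 - a * (n : Matrix (Fin 3) (Fin 3) F) 0 2 := by
  obtain ⟨hU, h01⟩ := (mem_unipotentRadical21_iff n).1 hn
  obtain ⟨n00, n11, n22, n10, n20, n21⟩ := entries_of_mem_upperUnitriangular hU
  have hprod : (((transvectionGL (1 : Fin 3) 0 (by decide) a)⁻¹ * n * transvectionGL (1 : Fin 3) 0 (by decide) a : GL (Fin 3) F) : Matrix (Fin 3) (Fin 3) F) =
      Matrix.transvection (1 : Fin 3) 0 (-a) * (n : Matrix (Fin 3) (Fin 3) F) * Matrix.transvection (1 : Fin 3) 0 a := by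
    rw [← transvectionGL_neg, Units.val_mul, Units.val_mul, coe_transvectionGL, coe_transvectionGL]
  have hent : ∀ i j, (((transvectionGL (1 : Fin 3) 0 (by decide) a)⁻¹ * n * transvectionGL (1 : Fin 3) 0 (by decide) a : GL (Fin 3) F) : Matrix (Fin 3) (Fin 3) F) i j =
      (Matrix.transvection (1 : Fin 3) 0 (-a) * (n : Matrix (Fin 3) (Fin 3) F) * Matrix.transvection (1 : Fin 3) 0 a) i j := fun i j => by rw [hprod]
  refine ⟨(mem_unipotentRadical21_iff _).2 ⟨mem_upperUnitriangular_of_entries ?_ ?_ ?_ ?_ ?_ ?_, ?_⟩, ?_, ?_⟩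
  all_goals rw [hent]; simp [Matrix.mul_apply, Fin.sum_univ_three, Matrix.transvection, Matrix.single_apply, h01, n00, n11, n22, n10, n20, n21]
  ring

/-- **THE TORUS `diag(1,b,1)` ON `U_Q`**: `x⁻¹ n x ∈ U_Q` with `(x⁻¹nx)₀₂ = n₀₂`, `(x⁻¹nx)₁₂ = b⁻¹ n₁₂`. [cite: BernsteinZelevinskyASENS1977, 4.7] -/
theorem torus_conj_unipotentRadical21 (b : Fˣ) {n : GL (Fin 3) F} (hn : n ∈ unipotentRadicalGL F ![false, false, true]) :
    (diagonalGL (Fin 3) F ![1, b, 1])⁻¹ * n * diagonalGL (Fin 3) F ![1, b, 1] ∈ unipotentRadicalGL F ![false, false, true] ∧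
      (((diagonalGL (Fin 3) F ![1, b, 1])⁻¹ * n * diagonalGL (Fin 3) F ![1, b, 1] : GL (Fin 3) F) : Matrix (Fin 3) (Fin 3) F) 0 2 = (n : Matrix (Fin 3) (Fin 3) F) 0 2 ∧
      (((diagonalGL (Fin 3) F ![1, b, 1])⁻¹ * n * diagonalGL (Fin 3) F ![1, b, 1] : GL (Fin 3) F) : Matrix (Fin 3) (Fin 3) F) 1 2 =
          ((b⁻¹ : Fˣ) : F) * (n : Matrix (Fin 3) (Fin 3) F) 1 2 := by
  obtain ⟨hU, h01⟩ := (mem_unipotentRadical21_iff n).1 hn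
  have hinv : (diagonalGL (Fin 3) F ![1, b, 1])⁻¹ = diagonalGL (Fin 3) F (![1, b, 1])⁻¹ := (map_inv _ _).symm
  have hinv' : diagonalGL (Fin 3) F ![1, b, 1] = (diagonalGL (Fin 3) F (![1, b, 1])⁻¹)⁻¹ := by rw [map_inv, inv_inv]
  rw [hinv, hinv']
  refine ⟨(mem_unipotentRadical21_iff _).2 ⟨diagonalGL_conj_mem_upperUnitriangular _ hU, ?_⟩, ?_, ?_⟩
  · rw [diagonalGL_conj_apply, h01]; simp
  · rw [diagonalGL_conj_apply]; simp
  · rw [diagonalGL_conj_apply]; simp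

/-- **THE WEYL SWAP `P_{(01)}` ON `U_Q`**: `x = P_{(01)}` (in the Levi) satisfies `x⁻¹ n x ∈ U_Q` with `(x⁻¹nx)₀₂ = n₁₂`, `(x⁻¹nx)₁₂ = n₀₂`.
[cite: BernsteinZelevinskyASENS1977, 4.7] -/
theorem swap_conj_unipotentRadical21 {n : GL (Fin 3) F} (hn : n ∈ unipotentRadicalGL F ![false, false, true]) :
    (permGL (Equiv.swap (0 : Fin 3) 1) : GL (Fin 3) F)⁻¹ * n * permGL (Equiv.swap (0 : Fin 3) 1) ∈ unipotentRadicalGL F ![false, false, true] ∧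
      (((permGL (Equiv.swap (0 : Fin 3) 1) : GL (Fin 3) F)⁻¹ * n * permGL (Equiv.swap (0 : Fin 3) 1) : GL (Fin 3) F) : Matrix (Fin 3) (Fin 3) F) 0 2 =
          (n : Matrix (Fin 3) (Fin 3) F) 1 2 ∧
      (((permGL (Equiv.swap (0 : Fin 3) 1) : GL (Fin 3) F)⁻¹ * n * permGL (Equiv.swap (0 : Fin 3) 1) : GL (Fin 3) F) : Matrix (Fin 3) (Fin 3) F) 1 2 =
          (n : Matrix (Fin 3) (Fin 3) F) 0 2 := by
  obtain ⟨hU, h01⟩ := (mem_unipotentRadical21_iff n).1 hn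
  obtain ⟨n00, n11, n22, n10, n20, n21⟩ := entries_of_mem_upperUnitriangular hU
  have hσ : (Equiv.swap (0 : Fin 3) 1)⁻¹ = Equiv.swap (0 : Fin 3) 1 := Equiv.swap_inv _ _
  have hx : (permGL (Equiv.swap (0 : Fin 3) 1) : GL (Fin 3) F)⁻¹ * n * permGL (Equiv.swap (0 : Fin 3) 1) =
      permGL (Equiv.swap (0 : Fin 3) 1) * n * (permGL (Equiv.swap (0 : Fin 3) 1))⁻¹ := by
    rw [permGL_inv, hσ]
  have hcoe : ∀ i j, (((permGL (Equiv.swap (0 : Fin 3) 1) : GL (Fin 3) F)⁻¹ * n * permGL (Equiv.swap (0 : Fin 3) 1) : GL (Fin 3) F) : Matrix (Fin 3) (Fin 3) F) i j =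
      (n : Matrix (Fin 3) (Fin 3) F) (Equiv.swap (0 : Fin 3) 1 i) (Equiv.swap (0 : Fin 3) 1 j) := by
    intro i j
    rw [hx, coe_permGL_mul_mul_inv, Matrix.submatrix_apply]
  have s0 : Equiv.swap (0 : Fin 3) 1 0 = 1 := Equiv.swap_apply_left _ _
  have s1 : Equiv.swap (0 : Fin 3) 1 1 = 0 := Equiv.swap_apply_right _ _
  have s2 : Equiv.swap (0 : Fin 3) 1 2 = 2 := Equiv.swap_apply_of_ne_of_ne (by decide) (by decide)
  refine ⟨(mem_unipotentRadical21_iff _).2 ⟨mem_upperUnitriangular_of_entries ?_ ?_ ?_ ?_ ?_ ?_, ?_⟩, ?_, ?_⟩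
  · rw [hcoe, s0, n11]
  · rw [hcoe, s1, n00]
  · rw [hcoe, s2, n22]
  · rw [hcoe, s1, s0, h01]
  · rw [hcoe, s2, s0, n21]
  · rw [hcoe, s2, s1, n20]
  · rw [hcoe, s0, s1, n10]
  · rw [hcoe, s0, s2]
  · rw [hcoe, s1, s2]

end Conjugation

end Summit.HodgeConjecture.HodgeConjecture.Cruxes.H413.K2E3GL3UnipotentCharacters

end
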